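import Summits.ResolutionOfSingularities.ResolutionOfSingularities.Theorems.PurelyInseparableDim4JointHereditaryDefs
import Summits.ResolutionOfSingularities.ResolutionOfSingularities.Theorems.PurelyInseparableDim4JointHereditaryModel
import Summits.ResolutionOfSingularities.ResolutionOfSingularities.Theorems.PurelyInseparableDim4JointShapeSurvivalSees
import Summits.ResolutionOfSingularities.ResolutionOfSingularities.Theorems.PurelyInseparableDim4JointSurvival
import Literature.AlgebraicGeometry.Resolution.BlowupDisjointCentreTransport
import HarnessLib

/-!
# Purely inseparable four-folds: SURVIVAL of a coordinate member with HEREDITARY waiting data under the blow-up of a disjoint centre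
# (brick S3 (c) «joint point∘coordinate chains», part 63 = v3-H survival; cell `res-dim4-pi`)

[OURS · counted 0] (D-0157 DOOR 2; host item stmt-ResolutionOfSingularities-16155, helper). Nothing here proves resolution of singularities
in dimension ≥ 4 / characteristic `p`. Part 51 (`memberData_survival`) in the v3-H format of part 60: a member `c` of `(X′, M′)` with
`MemberDataH`, disjoint together with its waiting regions from the blown-up centre, keeps `MemberDataH` at the blow-up (same state, centre,
tables; regions pulled back); the model-free boundary invariants («meeting the region ⇒ containing member and region», «meeting the member
⇒ containing it») travel along `π` because over the isomorphism locus a strict transform is supported exactly over its source.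

* §1 `member_survival_zigzag_shape_regions` (part 47 with the boundary-free region clause); §2 **`memberDataH_survival`**.

AI-produced formalisation, weaker than expert review. bears_on: LADDER-RESOLUTION:D157-DOOR2 (res-dim4-pi · S3 (c) joint v3-H · survival).
-/

set_option linter.dupNamespace false -- D-0017: single-problem summit path `Summit.<S>.<S>.…` by design

noncomputable section

open MvPolynomial Finset CategoryTheory AlgebraicGeometry Opposite TopologicalSpace
open AlgebraicGeometry.Scheme.IdealSheafData (ofIdealTop vanishingIdeal)

namespace Summit.ResolutionOfSingularities.ResolutionOfSingularities.Theorems.PIDim4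

open Literature.AlgebraicGeometry.Resolution
open Literature.AlgebraicGeometry.Resolution.AffinePointBlowup (P A γ coord Wtop ξ)

namespace Equimultiple

/-! ## §1 Survival of the chart with shape; regions may meet the boundary -/

section ShapeRegions

variable {K : Type} [Field K]
variable {X' W Y : Scheme.{0}} {π : W ⟶ X'} {Ce : X'.IdealSheafData} {S : Finset (Fin 4)}

/-- **SURVIVAL WITH SHAPE AND VISIBILITY OF REGIONS (regions may meet the boundary).** Part 47's `member_survival_zigzag_shape_sees`
with the region clause freed of its boundary hypothesis (and conclusion): for every seen set `D ⊆ ψ(Y)` with `φ(ψ⁻¹ D)` closed and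
disjoint from the centre, the survivor chart sees `D`, `φ′(ψ′⁻¹ D) = π⁻¹ φ(ψ⁻¹ D)` is closed. Chart, readings, ranges and translated shape as
in part 47. [cite: BierstoneGrigorievMilmanWlodarczyk2011, Def. 3.1.3 (2), (4)] [cite: StacksProject, Tag 02OS] -/
theorem member_survival_zigzag_shape_regions [IsLocallyNoetherian X'] [IsLocallyNoetherian W] (hπ : IsBlowup π Ce)
    (c : Closeds X') (hdisj : Disjoint (c : Set X') (Ce.support : Set X')) (φ : Y ⟶ X') [IsOpenImmersion φ]
    (ψ : Y ⟶ P 4 K) [IsOpenImmersion ψ] (I : X'.IdealSheafData) (J : (P 4 K).IdealSheafData)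
    (hI : I.comap φ = J.comap ψ) (μ : ℕ)
    (hZ : (vanishingIdeal c).comap φ = (AffineCoordBlowup.𝓘Λ 4 K (insert 0 (Fin.succ '' (S : Set (Fin 4))))).comap ψ)
    (hcφ : (c : Set X') ⊆ Set.range φ)
    (hsee : (AffineCoordBlowup.CΛ 4 K (insert 0 (Fin.succ '' (S : Set (Fin 4)))) : Set (P 4 K)) ⊆ Set.range ψ)
    (E : List X'.IdealSheafData) (idx : X'.IdealSheafData → Fin 4) (cst : X'.IdealSheafData → K)
    (hshape : ∀ D ∈ E,
      ((D.support : Set X') ∩ φ '' (ψ ⁻¹'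
        (AffineCoordBlowup.CΛ 4 K (insert 0 (Fin.succ '' (S : Set (Fin 4)))) : Set (P 4 K)))).Nonempty →
      D.comap φ = (ofIdealTop (Ideal.span {(γ 4 K).symm (X (idx D).succ + C (cst D))})).comap ψ ∧
        (idx D ∈ S → cst D = 0))
    (hinj : ∀ D₁ ∈ E, ∀ D₂ ∈ E,
      ((D₁.support : Set X') ∩ φ '' (ψ ⁻¹'
        (AffineCoordBlowup.CΛ 4 K (insert 0 (Fin.succ '' (S : Set (Fin 4)))) : Set (P 4 K)))).Nonempty →
      ((D₂.support : Set X') ∩ φ '' (ψ ⁻¹'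
        (AffineCoordBlowup.CΛ 4 K (insert 0 (Fin.succ '' (S : Set (Fin 4)))) : Set (P 4 K)))).Nonempty →
      idx D₁ = idx D₂ → D₁ = D₂) :
    ∃ (Y' : Scheme.{0}) (φ' : Y' ⟶ W) (ψ' : Y' ⟶ P 4 K) (_ : IsOpenImmersion φ') (_ : IsOpenImmersion ψ'),
      (controlledTransform π Ce I μ).comap φ' = J.comap ψ' ∧
      (vanishingIdeal (c.preimage π.continuous)).comap φ' =
        (AffineCoordBlowup.𝓘Λ 4 K (insert 0 (Fin.succ '' (S : Set (Fin 4))))).comap ψ' ∧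
      ((c.preimage π.continuous : Closeds W) : Set W) ⊆ Set.range φ' ∧
      (AffineCoordBlowup.CΛ 4 K (insert 0 (Fin.succ '' (S : Set (Fin 4)))) : Set (P 4 K)) ⊆ Set.range ψ' ∧
      (∀ D : Set (P 4 K), D ⊆ Set.range ψ → IsClosed (φ '' (ψ ⁻¹' D)) → Disjoint (φ '' (ψ ⁻¹' D)) (Ce.support : Set X') →
        D ⊆ Set.range ψ' ∧ φ' '' (ψ' ⁻¹' D) = π ⁻¹' (φ '' (ψ ⁻¹' D)) ∧ IsClosed (φ' '' (ψ' ⁻¹' D))) ∧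
      ∃ (idx₂ : W.IdealSheafData → Fin 4) (cst₂ : W.IdealSheafData → K),
        (∀ D₂ ∈ E.map (strictTransformIdeal π Ce) ++ [Ce.comap π],
          ((D₂.support : Set W) ∩ φ' '' (ψ' ⁻¹'
            (AffineCoordBlowup.CΛ 4 K (insert 0 (Fin.succ '' (S : Set (Fin 4)))) : Set (P 4 K)))).Nonempty →
          D₂.comap φ' = (ofIdealTop (Ideal.span {(γ 4 K).symm (X (idx₂ D₂).succ + C (cst₂ D₂))})).comap ψ' ∧
            (idx₂ D₂ ∈ S → cst₂ D₂ = 0)) ∧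
        (∀ D₁ ∈ E.map (strictTransformIdeal π Ce) ++ [Ce.comap π], ∀ D₂ ∈ E.map (strictTransformIdeal π Ce) ++ [Ce.comap π],
          ((D₁.support : Set W) ∩ φ' '' (ψ' ⁻¹'
            (AffineCoordBlowup.CΛ 4 K (insert 0 (Fin.succ '' (S : Set (Fin 4)))) : Set (P 4 K)))).Nonempty →
          ((D₂.support : Set W) ∩ φ' '' (ψ' ⁻¹'
            (AffineCoordBlowup.CΛ 4 K (insert 0 (Fin.succ '' (S : Set (Fin 4)))) : Set (P 4 K)))).Nonempty →
          idx₂ D₁ = idx₂ D₂ → D₁ = D₂) := by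
  classical
  set O : X'.Opens := ⟨(Ce.support : Set X')ᶜ, Ce.support.isClosed.isOpen_compl⟩ with hO_def
  have hO : Disjoint (O : Set X') Ce.support := disjoint_compl_left
  haveI : IsIso (π ∣_ O) := hπ.isIso_morphismRestrict hO
  have hcO : ∀ x : X', x ∈ (c : Set X') → x ∈ O := fun x hx h => hdisj.le_bot ⟨hx, h⟩
  have hmem := mem_member_iff_mem_CΛ φ ψ c hZ
  -- the transported chart (the construction of part 4, made explicit)
  set φ' : (φ ⁻¹ᵁ O : Scheme.{0}) ⟶ W := (φ ∣_ O) ≫ inv (π ∣_ O) ≫ (π ⁻¹ᵁ O).ι with hφ'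
  set ψ' : (φ ⁻¹ᵁ O : Scheme.{0}) ⟶ P 4 K := (φ ⁻¹ᵁ O).ι ≫ ψ with hψ'
  have hfac : φ' ≫ π = (φ ⁻¹ᵁ O).ι ≫ φ := comp_eq_of_zigzag_survival φ
  have hφ'π : ∀ y, π (φ' y) = φ ((φ ⁻¹ᵁ O).ι y) := fun y => by
    rw [← Scheme.Hom.comp_apply, hfac, Scheme.Hom.comp_apply]
  -- the survivor's centre set on the new chart is the old one
  have himg' : φ' '' (ψ' ⁻¹' (AffineCoordBlowup.CΛ 4 K (insert 0 (Fin.succ '' (S : Set (Fin 4)))) : Set (P 4 K))) ⊆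
      π ⁻¹' (φ '' (ψ ⁻¹' (AffineCoordBlowup.CΛ 4 K (insert 0 (Fin.succ '' (S : Set (Fin 4)))) : Set (P 4 K)))) := by
    rintro _ ⟨y, hy, rfl⟩
    rw [Set.mem_preimage, hφ'π]
    exact ⟨_, hy, rfl⟩
  -- members of the new boundary meeting the survivor come from members meeting `c`
  have hmeet : ∀ D₂ ∈ E.map (strictTransformIdeal π Ce) ++ [Ce.comap π],
      ((D₂.support : Set W) ∩ φ' '' (ψ' ⁻¹'
        (AffineCoordBlowup.CΛ 4 K (insert 0 (Fin.succ '' (S : Set (Fin 4)))) : Set (P 4 K)))).Nonempty →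
      ∃ D ∈ E, strictTransformIdeal π Ce D = D₂ ∧
        ((D.support : Set X') ∩ φ '' (ψ ⁻¹'
          (AffineCoordBlowup.CΛ 4 K (insert 0 (Fin.succ '' (S : Set (Fin 4)))) : Set (P 4 K)))).Nonempty := by
    intro D₂ hD₂ hne
    obtain ⟨w, hwD, hwc⟩ := hne
    have hπw := himg' hwc
    rw [Set.mem_preimage] at hπw
    rcases List.mem_append.mp hD₂ with hD₂ | hD₂
    · obtain ⟨D, hD, rfl⟩ := List.mem_map.mp hD₂
      refine ⟨D, hD, rfl, π w, ?_, hπw⟩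
      have hle : D.comap π ≤ strictTransformIdeal π Ce D :=
        (comap_le_controlledTransform π Ce D 0).trans (controlledTransform_le_strictTransformIdeal π Ce D 0)
      have hw' := Scheme.IdealSheafData.support_antitone hle hwD
      rw [Scheme.IdealSheafData.support_comap] at hw'
      exact hw'
    · -- the exceptional divisor does not meet the survivor
      exfalso
      rw [List.mem_singleton] at hD₂
      subst hD₂
      rw [Scheme.IdealSheafData.support_comap] at hwD
      have hπwc : π w ∈ (c : Set X') := by
        obtain ⟨y, hy, hyw⟩ := hπw
        rw [← hyw]
        exact (hmem y).mpr hy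
      exact hdisj.le_bot ⟨hπwc, hwD⟩
  -- the new shape data: read through a chosen old member
  let pick : W.IdealSheafData → X'.IdealSheafData := fun D₂ =>
    if h : ∃ D ∈ E, strictTransformIdeal π Ce D = D₂ ∧
        ((D.support : Set X') ∩ φ '' (ψ ⁻¹'
          (AffineCoordBlowup.CΛ 4 K (insert 0 (Fin.succ '' (S : Set (Fin 4)))) : Set (P 4 K)))).Nonempty
    then h.choose else ⊤
  have hpick : ∀ D₂ ∈ E.map (strictTransformIdeal π Ce) ++ [Ce.comap π],
      ((D₂.support : Set W) ∩ φ' '' (ψ' ⁻¹'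
        (AffineCoordBlowup.CΛ 4 K (insert 0 (Fin.succ '' (S : Set (Fin 4)))) : Set (P 4 K)))).Nonempty →
      pick D₂ ∈ E ∧ strictTransformIdeal π Ce (pick D₂) = D₂ ∧
        (((pick D₂).support : Set X') ∩ φ '' (ψ ⁻¹'
          (AffineCoordBlowup.CΛ 4 K (insert 0 (Fin.succ '' (S : Set (Fin 4)))) : Set (P 4 K)))).Nonempty := by
    intro D₂ hD₂ hne
    have h := hmeet D₂ hD₂ hne
    have hp : pick D₂ = h.choose := dif_pos h
    rw [hp]
    exact h.choose_spec
  -- visibility of a seen region survives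
  have hvis : ∀ D : Set (P 4 K), D ⊆ Set.range ψ → IsClosed (φ '' (ψ ⁻¹' D)) → Disjoint (φ '' (ψ ⁻¹' D)) (Ce.support : Set X') →
      D ⊆ Set.range ψ' ∧ φ' '' (ψ' ⁻¹' D) = π ⁻¹' (φ '' (ψ ⁻¹' D)) ∧ IsClosed (φ' '' (ψ' ⁻¹' D)) := by
    intro D hDsee hDc hDdisj
    have hDO : ∀ y : Y, ψ y ∈ D → φ y ∈ O := fun y hy h => hDdisj.le_bot ⟨⟨y, hy, rfl⟩, h⟩
    have himgD : φ' '' (ψ' ⁻¹' D) = π ⁻¹' (φ '' (ψ ⁻¹' D)) := by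
      ext w
      constructor
      · rintro ⟨y, hy, rfl⟩
        rw [Set.mem_preimage, hφ'π]
        exact ⟨_, hy, rfl⟩
      · rintro ⟨y, hy, hyw⟩
        have hyO : y ∈ φ ⁻¹ᵁ O := hDO y hy
        refine ⟨⟨y, hyO⟩, hy, ?_⟩
        refine eq_of_eq_of_not_mem_support hπ ?_ ?_
        · rw [hφ'π]; exact hyw
        · rw [hφ'π]; exact fun h => hO.le_bot ⟨hyO, h⟩
    refine ⟨fun x hx => ?_, himgD, by rw [himgD]; exact hDc.preimage π.continuous⟩
    obtain ⟨y, rfl⟩ := hDsee hx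
    exact ⟨⟨y, hDO y hx⟩, rfl⟩
  refine ⟨(φ ⁻¹ᵁ O : Y.Opens), φ', ψ', inferInstance, inferInstance, ?_, ?_, ?_, ?_, hvis,
    fun D₂ => idx (pick D₂), fun D₂ => cst (pick D₂), fun D₂ hD₂ hne => ?_, fun D₁ hD₁ D₂ hD₂ hne₁ hne₂ hidx => ?_⟩
  · rw [hφ', Scheme.IdealSheafData.comap_comp, Scheme.IdealSheafData.comap_comp, comap_controlledTransform_ι_of_disjoint Ce I hO,
      ← Scheme.IdealSheafData.comap_comp _ (inv (π ∣_ O)), IsIso.inv_hom_id, Scheme.IdealSheafData.comap_id,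
      ← Scheme.IdealSheafData.comap_comp, morphismRestrict_ι, Scheme.IdealSheafData.comap_comp, hI,
      ← Scheme.IdealSheafData.comap_comp]
  · rw [← hπ.comap_vanishingIdeal_of_disjoint c hdisj, ← Scheme.IdealSheafData.comap_comp, hfac,
      Scheme.IdealSheafData.comap_comp, hZ, ← Scheme.IdealSheafData.comap_comp]
  · intro w hw
    have hwc : π w ∈ (c : Set X') := hw
    obtain ⟨y, hy⟩ := hcφ hwc
    have hyO : y ∈ φ ⁻¹ᵁ O := by
      change φ y ∈ O
      rw [hy]
      exact hcO _ hwc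
    have hwO : w ∈ π ⁻¹ᵁ O := hcO _ hwc
    refine ⟨⟨y, hyO⟩, ?_⟩
    have h1 : (φ ∣_ O) ⟨y, hyO⟩ = (π ∣_ O) ⟨w, hwO⟩ := by
      apply Subtype.ext
      rw [morphismRestrict_base_coe, morphismRestrict_base_coe]
      exact hy
    rw [hφ', Scheme.Hom.comp_apply, Scheme.Hom.comp_apply, h1, ← Scheme.Hom.comp_apply (π ∣_ O), IsIso.hom_inv_id]
    rfl
  · intro v hv
    obtain ⟨y, hy⟩ := hsee hv
    have hyc : φ y ∈ (c : Set X') := (hmem y).mpr (by rw [hy]; exact hv)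
    exact ⟨⟨y, hcO _ hyc⟩, by rw [hψ', Scheme.Hom.comp_apply]; exact hy⟩
  · -- the reading of a meeting member
    obtain ⟨hD, hst, hne'⟩ := hpick D₂ hD₂ hne
    obtain ⟨hread, hzero⟩ := hshape _ hD hne'
    refine ⟨?_, hzero⟩
    show D₂.comap φ' = (ofIdealTop (Ideal.span {(γ 4 K).symm (X (idx (pick D₂)).succ + C (cst (pick D₂)))})).comap ψ'
    conv_lhs => rw [← hst, hφ', comap_strictTransformIdeal_zigzag_survival hO φ, hread]
    rw [hψ', ← Scheme.IdealSheafData.comap_comp]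
  · -- injectivity of the index on meeting members
    obtain ⟨hD₁', hst₁, hne₁'⟩ := hpick D₁ hD₁ hne₁
    obtain ⟨hD₂', hst₂, hne₂'⟩ := hpick D₂ hD₂ hne₂
    have h := hinj _ hD₁' _ hD₂' hne₁' hne₂' hidx
    rw [← hst₁, ← hst₂, h]


end ShapeRegions

/-! ## §2 `MemberDataH` survives -/

section SurvivalH

variable {K : Type} [Field K] {p : ℕ} [hp : Fact p.Prime] [CharP K p] [DecidableEq K]
variable {X' W : Scheme.{0}} {π : W ⟶ X'} {Ce : X'.IdealSheafData}

omit hp [CharP K p] [DecidableEq K] in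
/-- **Over a closed set disjoint from the centre, a strict transform is supported exactly over its source**: if `A ⊆ V(D)` is closed
and disjoint from `V(Ce)` then `π⁻¹ A ⊆ V(σˢ D)`. [cite: GortzWedhorn2020, (13.19) p. 414] -/
theorem preimage_subset_support_strictTransformIdeal [IsLocallyNoetherian X'] [IsLocallyNoetherian W] (hπ : IsBlowup π Ce)
    (A : Closeds X') (hA : Disjoint (A : Set X') (Ce.support : Set X')) (D : X'.IdealSheafData)
    (hAD : (A : Set X') ⊆ D.support) : π ⁻¹' (A : Set X') ⊆ ((strictTransformIdeal π Ce D).support : Set W) := by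
  intro w hw
  have hd : Disjoint (Ce.support : Set X') ((vanishingIdeal A).support : Set X') := by
    rw [coe_support_vanishingIdeal]; exact hA.symm
  have hw' : π w ∈ ((vanishingIdeal A).support : Set X') := by rw [coe_support_vanishingIdeal]; exact hw
  exact (hπ.mem_support_strictTransformIdeal_iff_of_mem_support_of_disjoint hd D hw').mpr (hAD hw)

/-- **A MEMBER WITH HEREDITARY WAITING DATA SURVIVES THE BLOW-UP OF A DISJOINT CENTRE.** See the module docstring.
[cite: BierstoneGrigorievMilmanWlodarczyk2011, Def. 3.1.3 (2), (4)] [cite: StacksProject, Tag 02OS] -/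
theorem memberDataH_survival [IsAlgClosed K] [IsLocallyNoetherian X'] [IsLocallyNoetherian W] (hπ : IsBlowup π Ce)
    (M' : MarkedIdeal X') (hmult : M'.mult = p) (hsncC : HasSNCWith M'.boundary Ce)
    (plan : State K → Finset (Fin 4) → Finset (Fin 4 × (Fin 4 → K) × Finset (Fin 4)))
    (leaves : State K → Finset (Fin 4) → Finset (Fin 4 × (Fin 4 → K)))
    (wplan : State K → Finset (Fin 4) → Finset (Fin 4 × (Fin 4 → K) × Finset (Fin 4)))
    (c : Closeds X') (hdisj : Disjoint (c : Set X') (Ce.support : Set X')) {s : State K} {S : Finset (Fin 4)}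
    {wr : Fin 4 × (Fin 4 → K) × Finset (Fin 4) → Closeds X'} (h : MemberDataH p plan leaves wplan M' c s S wr)
    (hregdisj : ∀ wt ∈ wplan s S, Disjoint (wr wt : Set X') (Ce.support : Set X')) :
    MemberDataH p plan leaves wplan (M'.transform π Ce) (c.preimage π.continuous) s S
      (fun wt => (wr wt).preimage π.continuous) := by
  obtain ⟨hF, hclean, hS, hreg, hsnc, hchart, hblocks, hacc, hinv, hHB⟩ := h
  obtain ⟨Y, φ, ψ, _, _, hM, hZ, hcφ, hsee, ⟨idx, cst_, hshape, hinj⟩, hregions⟩ := hchart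
  -- global survival
  obtain ⟨hreg', -, hsnc'⟩ := member_survival_global hπ M' c hdisj hreg
    (coe_member_subset_support φ ψ M' hmult _ hM hS.2 c hZ hcφ) hsncC hsnc
  -- the survivor chart with shape and visibility of regions
  obtain ⟨Y', φ', ψ', _, _, hM', hZ', hcφ', hsee', hvis, idx₂, cst₂, hshape₂, hinj₂⟩ :=
    member_survival_zigzag_shape_regions hπ c hdisj φ ψ M'.ideal (hypSheaf p s.F) hM M'.mult hZ hcφ hsee M'.boundary idx cst_
      hshape hinj
  have hvis' : ∀ wt ∈ wplan s S, waitingSetZ wt ⊆ Set.range ψ' ∧ φ' '' (ψ' ⁻¹' waitingSetZ wt) = π ⁻¹' (wr wt : Set X') := by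
    intro wt hwt
    obtain ⟨hweq, hwsee⟩ := hregions wt hwt
    obtain ⟨h1, h2, -⟩ := hvis (waitingSetZ wt) hwsee (by rw [← hweq]; exact (wr wt).isClosed)
      (by rw [← hweq]; exact hregdisj wt hwt)
    rw [← hweq] at h2
    exact ⟨h1, h2⟩
  -- the new boundary
  have hbd : ∀ D₂ ∈ (M'.transform π Ce).boundary, D₂ = Ce.comap π ∨ ∃ D ∈ M'.boundary, D₂ = strictTransformIdeal π Ce D := by
    intro D₂ hD₂
    change D₂ ∈ M'.boundary.map (strictTransformIdeal π Ce) ++ [Ce.comap π] at hD₂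
    rw [List.mem_append, List.mem_map, List.mem_singleton] at hD₂
    rcases hD₂ with ⟨D, hD, rfl⟩ | h
    · exact Or.inr ⟨D, hD, rfl⟩
    · exact Or.inl h
  have hEdisj : ∀ A : Closeds X', Disjoint (A : Set X') (Ce.support : Set X') →
      Disjoint ((Ce.comap π).support : Set W) (π ⁻¹' (A : Set X')) := fun A hA => by
    refine Set.disjoint_left.mpr fun w hw hw' => ?_
    rw [Scheme.IdealSheafData.support_comap] at hw
    exact hA.le_bot ⟨hw', hw⟩
  refine ⟨hF, hclean, hS, hreg', hsnc', ⟨Y', φ', ψ', inferInstance, inferInstance, hM', hZ', hcφ', hsee',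
    ⟨idx₂, cst₂, hshape₂, hinj₂⟩, fun wt hwt => ?_⟩, hblocks, hacc, fun wt hwt D₂ hD₂ => ?_, fun hpre D₂ hD₂ hm => ?_⟩
  · -- the preimage region is seen through the survivor chart
    obtain ⟨h1, h2⟩ := hvis' wt hwt
    exact ⟨by rw [h2]; rfl, h1⟩
  · -- «meeting the region ⇒ containing member and region» survives
    rcases hbd D₂ hD₂ with rfl | ⟨D, hD, rfl⟩
    · exact Or.inl (hEdisj (wr wt) (hregdisj wt hwt))
    · rcases hinv wt hwt D hD with h | ⟨h1, h2⟩
      · refine Or.inl (Set.disjoint_left.mpr fun w hw hw' => ?_)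
        exact Set.disjoint_left.mp h (ChartDictionary.support_strictTransformIdeal_subset_preimage π _ D hw) hw'
      · exact Or.inr ⟨preimage_subset_support_strictTransformIdeal hπ c hdisj D h1,
          preimage_subset_support_strictTransformIdeal hπ (wr wt) (hregdisj wt hwt) D h2⟩
  · -- «meeting the member ⇒ containing it» survives
    rcases hbd D₂ hD₂ with rfl | ⟨D, hD, rfl⟩
    · exact absurd (Set.disjoint_iff_inter_eq_empty.mp (hEdisj c hdisj)) hm.ne_empty
    · obtain ⟨w, hw1, hw2⟩ := hm
      have hmD : ((D.support : Set X') ∩ (c : Set X')).Nonempty :=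
        ⟨π w, ChartDictionary.support_strictTransformIdeal_subset_preimage π _ D hw1, hw2⟩
      exact preimage_subset_support_strictTransformIdeal hπ c hdisj D (hHB hpre D hD hmD)

end SurvivalH

end Equimultiple

end Summit.ResolutionOfSingularities.ResolutionOfSingularities.Theorems.PIDim4

end
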